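import Literature.NumberTheory.EllipticCurves.HeegnerPointsOfConductor
import Literature.NumberTheory.EllipticCurves.KolyvaginShaStructureIndexFormProofs
import Mathlib.NumberTheory.ModularForms.DedekindEta
import HarnessLib


/-!
# The `η`-quotient `η(τ)/η(49τ)` on `X₀(49)` and the `2`-isogeny descent class of its conductor-one Heegner points
# (Ligozat 1975; Deuring's factorisation of `Δ`-quotients, Lang *Elliptic Functions* Ch. 12 §2)

Three cite-tagged statements (`def … : Prop`, nothing asserted), typed for the consumer THEOREM A‴ of cell `bsd-goldfeld`
(seat `bsd-goldfeld-s1p-c3x`, `Summits/BirchSwinnertonDyer/BirchSwinnertonDyer/Theorems/GoldfeldAllTwistsTwoConverseTwinHalfTraceThreeModEight*.lean`;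
memo `run/shared/lean/pub/bsd-goldfeld/F3-ETA-DESCENT.md`):

* `x049_x_sub_two_eq_etaQuotient` — (F-η): on `X₀(49) ≅ 49a1 = [1,−1,0,−2,−1]` (cusp `∞ ↦ O`, cusp `0 ↦ T = (2,−1)`), for the
  optimal modular parametrisation `φ` (Manin constant `±1`), `x(φ(τ)) − 2 = η(τ)/η(49τ)` for every `τ ∈ ℍ`. PROOF IN PRINT: `η(τ)/η(49τ)`
  is a modular unit on `Γ₀(49)` (Ligozat's criterion, Prop. 3.1.1 / Kilford Thm 5.7: `Σδ r_δ = −48`, `Σ(49/δ) r_δ = 48`, `∏ δ^{r_δ} = 7⁻²`)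
  with divisor `2[0] − 2[∞]` (Ligozat's order formula at the cusps `∞, 0, a/7`), as is `x − 2` (double pole at `O`, double zero at the
  `2`-torsion point `T`, which is the image of the cusp `0`); two functions with the same divisor and the same leading `q`-coefficient
  coincide. (Ligozat tabulates `X₀(49)` with the normal form `y² = x(x² + 21x + 112)`, p. 45: «le point (0,0) donne b = 7».) Certified
  as a `q`-series identity to `O(q²³⁹)` (kit j288710).
* `deuring_etaQuotient49_heegner_generates_conjPrime` — (F-D): for `K` imaginary quadratic with `7 = 𝔮𝔮̄` split and `τ₁` a Heegner
  point of level `49` and conductor `1` for `(𝒪_K, 𝔫 = 𝔮²)`, the value `u = η(τ₁)/η(49τ₁)` lies in the Hilbert class field `H = K[1]`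
  and generates the ideal `𝔮̄·𝒪_H`: `u²⁴ = 49¹²·Δ(𝔞)/Δ(𝔞𝔫⁻¹)` and Lang, *Elliptic Functions*, Ch. 12 §2 Thm 5 (Deuring):
  `7¹²Δ(𝔮𝔟)/Δ(𝔟) ≈ 𝔮̄¹²`, applied twice.
* `x049_heegner_norm_x_sub_two_not_mem` — (F-norm), the CONSUMABLE COROLLARY of (F-η)+(F-D) in the tree's Heegner-point currency
  (`KolyvaginHeegnerData.y = y(1) ∈ E(K[1])` for an optimal datum): `x(y(1)) ≠ ∞`, and `β := N_{K[1]/K}(x(y(1)) − 2)` is an algebraic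
  integer outside a prime `𝔮 ∣ 7` of `K` at which `7` is unramified (`(β) = 𝔮̄^{h_K}`, and `7 ∤ d_K` because `d_K` is a square modulo
  `4·49`). This is the ONE binder `hEta` of THEOREM A‴.

HONEST FRAMING: statements only; nothing here is proved in the kernel; (F-η) and (F-D) are classical theorems (1975 / 1940s), (F-norm) their
six-line consequence (memo §3–§4). They concern CM values of a modular unit; they say nothing about BSD.

References: G. Ligozat, *Courbes modulaires de genre 1*, Mém. SMF 43 (1975), Prop. 3.1.1 and the table for `N = 49` (p. 45) [Ligozat1975];
S. Lang, *Elliptic Functions*, GTM 112 (1987), Ch. 12 §2, Thm 4 and Thm 5 [Lang1987]; B. Gross, *Heegner points on X₀(N)* (1984) §§4–5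
[Gross1984].
-/

noncomputable section

open scoped UpperHalfPlane

open WeierstrassCurve IsDedekindDomain NumberField
open Literature.NumberTheory.EllipticCurves Literature.NumberTheory.EllipticCurves.ModularForms

namespace Literature.NumberTheory.EllipticCurves

/-- **(F-η) — `x − 2 = η(τ)/η(49τ)` on `X₀(49)`.** For every modular parametrisation datum `D` of `X₀(49) → 49a1 = cm7` with Manin
constant `|c| = 1` and every `τ` in the upper half plane, `φ_D(τ)` is the affine point with `x`-coordinate `2 + η(τ)/η(49τ)`
(Mathlib's `ModularForm.eta`; `49τ ∈ ℍ` written `UpperHalfPlane.ofComplex (49τ)`). Ligozat 1975: `η(τ)/η(49τ)` is a unit on `X₀(49)` with divisor `2[0] − 2[∞] = div(x − 2)`, and both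
`q`-expansions start `q⁻² − q⁻¹ + …`. [cite: Ligozat1975, Prop. 3.1.1 and table N = 49 (p. 45)] -/
def x049_x_sub_two_eq_etaQuotient : Prop :=
  ∀ (D : ModularParametrizationData cm7 49), |D.c| = 1 → ∀ τ : ℍ,
    ∃ (yτ : ℂ) (h : (cm7.baseChange ℂ).toAffine.Nonsingular
        (2 + ModularForm.eta τ / ModularForm.eta (UpperHalfPlane.ofComplex (49 * (τ : ℂ)))) yτ),
      D.φ τ = .some (2 + ModularForm.eta τ / ModularForm.eta (UpperHalfPlane.ofComplex (49 * (τ : ℂ)))) yτ h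

/-- **(F-D) — Deuring's factorisation of the `η`-quotient at conductor-one Heegner points of level `49`.** For `K` imaginary
quadratic, `ι : K → ℂ`, a level-`49` Heegner datum `H` for `d_K` (so `7` splits in `K`) and a representative form `Q ∈ H.reps` with
Heegner point `τ_Q ∈ ℍ`: the value `η(τ_Q)/η(49τ_Q)` is an algebraic integer `u` of the Hilbert class field `K[1] ⊂ ℂ` and generates
the extension `𝔮̄·𝓞_{K[1]}` of a prime `𝔮̄ ∋ 7` of `𝓞_K` (the conjugate of the prime `𝔮` with `𝔫 = 𝔮²`): `u²⁴ = 49¹²Δ(𝔞)/Δ(𝔞𝔫⁻¹)`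
and Lang, *Elliptic Functions*, Ch. 12 §2 Thm 4 (integrality) and Thm 5 (`7¹²Δ(𝔮𝔟)/Δ(𝔟) ≈ 𝔮̄¹²`, applied twice). Stated in the
weaker form «for SOME prime of `K` containing `7`». REPAIRED IN PLACE 2026-08-28: the hypothesis `IsImaginaryQuadratic K` (under
which alone `heegnerTau`, `ringClassField` and `HeegnerDatum` mean what the source means) was missing from the first typing, which was
therefore false for junk `K` (`K = ℚ`, `d_K = 8`; kernel refutation `not_deuring_etaQuotient49_heegner_generates_conjPrime` in
`X049EtaDescentProofs`); the body below is now IDENTICAL to `deuring_etaQuotient49_heegner_generates_conjPrime'`.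
[cite: Lang1987, Ch. 12 §2 Thm. 4 and Thm. 5] [cite: Gross1984, §§4–5] -/
def deuring_etaQuotient49_heegner_generates_conjPrime : Prop :=
  ∀ (K : Type) [Field K] [NumberField K] (ι : K →+* ℂ), IsImaginaryQuadratic K →
    ∀ (H : HeegnerDatum 49 (NumberField.discr K)) (Q : ℤ × ℤ × ℤ), Q ∈ H.reps →
    ∃ (u : 𝓞 (ringClassField K ι 1)) (v : HeightOneSpectrum (𝓞 K)),
      ((u : ringClassField K ι 1) : ℂ) =
          ModularForm.eta (heegnerTau Q) / ModularForm.eta (UpperHalfPlane.ofComplex (49 * ((heegnerTau Q : ℍ) : ℂ))) ∧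
      (7 : 𝓞 K) ∈ v.asIdeal ∧
      Ideal.span {u} = v.asIdeal.map (algebraMap (𝓞 K) (𝓞 (ringClassField K ι 1)))

/-- **(F-norm) — the `2`-isogeny descent class of a conductor-one Heegner point of `X₀(49)` is prime to one prime over `7`.**
For `K` imaginary quadratic, `ι : K → ℂ`, an optimal parametrisation datum `D` of `cm7` at level `49` (`|D.c| = 1`), `β² ≡ d_K (mod 196)`
and Kolyvagin–Heegner data `d` of conductor `1` (so `d.y = y(1) ∈ X₀(49)(K[1])` is the Heegner point `φ_D(x(1))`): `y(1)` is an affine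
point `(x, y)` and there are an algebraic integer `b ∈ 𝓞_K` with `N_{K[1]/K}(x − 2) = b` and a prime `𝔮` of `𝓞_K` with `7 ∈ 𝔮`,
`7 ∉ 𝔮²`, `b ∉ 𝔮`. DERIVATION (memo F3-ETA-DESCENT §3–§4): by (F-η) `x − 2 = u(τ₁) = η(τ₁)/η(49τ₁)`; by Deuring (Lang, EF Ch. 12 §2
Thm 5, twice, `𝔫 = 𝔮'²`) `(u(τ₁))𝒪_{K[1]} = 𝔮̄'𝒪_{K[1]}`, so `(b) = 𝔮̄'^{h_K}` and `b ∉ 𝔮'`; `7 ∤ d_K` (as `d_K ≡ β² (mod 49)` is a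
fundamental discriminant), so `7 = 𝔮'𝔮̄'` is unramified: `7 ∉ 𝔮'²`. REPAIRED IN PLACE 2026-08-28: the hypothesis
`IsImaginaryQuadratic K` was missing from the first typing (false for junk `K`, e.g. the cubic field of discriminant `−31`); the body below
is now IDENTICAL to `x049_heegner_norm_x_sub_two_not_mem'`, which is PROVED from (F-η) + (F-D′) in `X049EtaDescentNormProofs`.
[cite: Ligozat1975, Prop. 3.1.1 and table N = 49 (p. 45)] [cite: Lang1987, Ch. 12 §2 Thm. 4 and Thm. 5] [cite: Gross1984, §§4–5] -/
def x049_heegner_norm_x_sub_two_not_mem : Prop :=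
  ∀ (K : Type) [Field K] [NumberField K] (ι : K →+* ℂ), IsImaginaryQuadratic K →
    ∀ (D : ModularParametrizationData cm7 49), |D.c| = 1 →
    ∀ (β : ℤ) (d : KolyvaginHeegnerData D β ι 1),
    ∃ (x y : ringClassField K ι 1) (h : (cm7.baseChange (ringClassField K ι 1)).toAffine.Nonsingular x y),
      d.y = .some x y h ∧
      ∃ (b : 𝓞 K) (v : HeightOneSpectrum (𝓞 K)),
        Algebra.norm K (x - 2) = (b : K) ∧ (7 : 𝓞 K) ∈ v.asIdeal ∧ (7 : 𝓞 K) ∉ v.asIdeal ^ 2 ∧ b ∉ v.asIdeal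

/-! ## The primed aliases (2026-08-28): the imaginary-quadratic hypothesis

As first typed, (F-D) and (F-norm) above quantified over EVERY number field `K`. Off the imaginary quadratic fields the tree's `heegnerTau`
(junk value `UpperHalfPlane.I` at non-positive-definite triples) and `ringClassField` (`= ι(K)` when `reducedForms (n² d_K) = ∅`,
e.g. `d_K > 0`) take junk values, and the two statements then assert false things (e.g. (F-D) at `K = ℚ`, `H = ⟨1, {(49,1,0)}⟩`
forces `η(i)/η(49i) = ±7`, and at a field of discriminant `8` it forces `7𝓞_K` to be prime although `7` splits in `ℚ(√2)`;
see `X049EtaDescentProofs` for the kernel refutation of (F-D) as typed). The primed versions below add the hypothesis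
`IsImaginaryQuadratic K` under which the cited theorems apply VERBATIM (every consumer in `Summits/…/GoldfeldAllTwistsTwoConverseTwin*`
applies the facts at an imaginary quadratic `K` with `hK : IsImaginaryQuadratic K` in context). Since the in-place repair of the unprimed
definitions (same day) the primed and unprimed statements are IDENTICAL; both names are kept because both are referenced. -/

/-- **(F-D′) — Deuring's factorisation of the `η`-quotient at conductor-one Heegner points of level `49`, for `K` IMAGINARY
QUADRATIC** (alias of `deuring_etaQuotient49_heegner_generates_conjPrime`; introduced when that definition still omitted the hypothesis
`IsImaginaryQuadratic K`; identical to it since its in-place repair). For `K` imaginary quadratic, `ι : K → ℂ`, a level-`49` Heegner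
datum `H` for `d_K` (so `7 = 𝔮𝔮̄` splits in `K`) and a representative form `Q ∈ H.reps` with Heegner point `τ_Q ∈ ℍ`: the value
`η(τ_Q)/η(49τ_Q)` is an algebraic integer `u` of the Hilbert class field `K[1] ⊂ ℂ` and generates the extension `𝔮̄·𝓞_{K[1]}` of a
prime `𝔮̄ ∋ 7` of `𝓞_K`: `u²⁴ = 49¹²Δ(𝔞)/Δ(𝔞𝔫⁻¹)` and Lang, *Elliptic Functions*, Ch. 12 §2 Thm 4 (integrality) and Thm 5
(`7¹²Δ(𝔮𝔟)/Δ(𝔟) ≈ 𝔮̄¹²`, applied twice); memo `run/shared/lean/pub/bsd-goldfeld/F3-ETA-DESCENT.md` §3, certified numerically for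
31 discriminants (kit j288710). [cite: Lang1987, Ch. 12 §2 Thm. 4 and Thm. 5] [cite: Gross1984, §§4–5] -/
def deuring_etaQuotient49_heegner_generates_conjPrime' : Prop :=
  ∀ (K : Type) [Field K] [NumberField K] (ι : K →+* ℂ), IsImaginaryQuadratic K →
    ∀ (H : HeegnerDatum 49 (NumberField.discr K)) (Q : ℤ × ℤ × ℤ), Q ∈ H.reps →
    ∃ (u : 𝓞 (ringClassField K ι 1)) (v : HeightOneSpectrum (𝓞 K)),
      ((u : ringClassField K ι 1) : ℂ) =
          ModularForm.eta (heegnerTau Q) / ModularForm.eta (UpperHalfPlane.ofComplex (49 * ((heegnerTau Q : ℍ) : ℂ))) ∧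
      (7 : 𝓞 K) ∈ v.asIdeal ∧
      Ideal.span {u} = v.asIdeal.map (algebraMap (𝓞 K) (𝓞 (ringClassField K ι 1)))

/-- **(F-norm′) — the `2`-isogeny descent class of a conductor-one Heegner point of `X₀(49)` is prime to one prime over `7`,
for `K` IMAGINARY QUADRATIC** (alias of `x049_heegner_norm_x_sub_two_not_mem`; introduced when that definition still omitted the
hypothesis `IsImaginaryQuadratic K`; identical to it since its in-place repair). For `K` imaginary quadratic, `ι : K → ℂ`, an optimal parametrisation datum `D` of `cm7` at level `49`
(`|D.c| = 1`), `β² ≡ d_K (mod 196)` and Kolyvagin–Heegner data `d` of conductor `1` (`d.y = y(1) ∈ X₀(49)(K[1])`): `y(1)` is an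
affine point `(x, y)` and there are `b ∈ 𝓞_K` with `N_{K[1]/K}(x − 2) = b` and a prime `𝔮` of `𝓞_K` with `7 ∈ 𝔮`, `7 ∉ 𝔮²`,
`b ∉ 𝔮`. DERIVATION: (F-η) + (F-D′) (memo F3-ETA-DESCENT §3–§4): `x − 2 = η(τ₁)/η(49τ₁)` generates `𝔮̄'𝓞_{K[1]}`, so
`(b) = 𝔮̄'^{h_K}` and `b ∉ 𝔮'`; `7 ∤ d_K` (as `d_K ≡ β² (mod 49)` is fundamental), so `7 = 𝔮'𝔮̄'` is unramified.
[cite: Ligozat1975, Prop. 3.1.1 and table N = 49 (p. 45)] [cite: Lang1987, Ch. 12 §2 Thm. 4 and Thm. 5] [cite: Gross1984, §§4–5] -/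
def x049_heegner_norm_x_sub_two_not_mem' : Prop :=
  ∀ (K : Type) [Field K] [NumberField K] (ι : K →+* ℂ), IsImaginaryQuadratic K →
    ∀ (D : ModularParametrizationData cm7 49), |D.c| = 1 →
    ∀ (β : ℤ) (d : KolyvaginHeegnerData D β ι 1),
    ∃ (x y : ringClassField K ι 1) (h : (cm7.baseChange (ringClassField K ι 1)).toAffine.Nonsingular x y),
      d.y = .some x y h ∧
      ∃ (b : 𝓞 K) (v : HeightOneSpectrum (𝓞 K)),
        Algebra.norm K (x - 2) = (b : K) ∧ (7 : 𝓞 K) ∈ v.asIdeal ∧ (7 : 𝓞 K) ∉ v.asIdeal ^ 2 ∧ b ∉ v.asIdeal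

end Literature.NumberTheory.EllipticCurves

end
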